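import Summits.BirchSwinnertonDyer.BirchSwinnertonDyer.Theorems.PrintCf2RamifiedOffTYZLayerOneSilenceOdd
import Summits.BirchSwinnertonDyer.BirchSwinnertonDyer.Theorems.PrintCf2RamifiedOffTYZLevelTwoTwoPrimes
import Summits.BirchSwinnertonDyer.BirchSwinnertonDyer.Theorems.PrintCf2RamifiedOffTYZGaloisMotion
import HarnessLib

/-!
# Crux `PrintCf2.RamifiedOffTYZOfFacts` (stmt-BirchSwinnertonDyer-20509), line `offtyz-v7`, LEAD cycle 11 (cruxlead-20509 g10), part 4c:
# ON THE TWO-PRIME JUMP-ONE SECTOR EVERY SQUARE OF `Gal(ℍ′_n/ℚ)` FIXES THE GENUS PERIOD `Z(lm)` ITSELF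

THEOREMS ONLY (no `def`, no named fact, no `sorry`), `--supports stmt-BirchSwinnertonDyer-20509`.  Combines the Layer-1 silence for odd `n`
(`LayerOneSilenceOdd.galPt_sq_genusPoint_eq_of_card_selmer_odd`, p722669: squares fix the genus POINT `P(n)` when `s(n) ≥ 2`) with the two-prime
closed form (`LevelTwoTwoPrimes.P_eq_of_two_primes`, p720648: `P(lm) = Z(lm) ∓ 𝓛(l)·Z(m)`, `P(m) = Z(m)`) and g4's torsion/half bookkeeping
(`GaloisMotion.galPt_eq_self_of_isOfFinAddOrder`; Lemma 3.18 display).  Hypotheses = the displays of g7/g8's mover criterion, Thm 1.1, Lemma 3.18,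
`𝓛(l) = 2c′` (Thm 1.1 at `l ≡ 1 (mod 8)`), Thm 3.5 at the prime `m` read inside `ℍ′_{lm}` with a `K_m`-RATIONAL `α_m` (`Point.map (D.embK m) α`), and
`#Sel₂(E_{lm}) = 2^{2+s}`, `s ≥ 2` (the types R1/R2 have `s = 3`).  Nothing is asserted; BSD is not proved by any of this; no class is closed.

**`galPt_sq_genusPeriod_eq_two_primes`**: `n = lm`, `l ≡ 1 (mod 8)`, `m ≡ 5` or `7 (mod 8)` primes; then for every `g ∈ Gal(ℍ′_n/ℚ)`,
**`g²·Z(lm) = Z(lm)`**.  So the beyond-print object of the line on this sector — the genus period `Z(lm) = Σ_{t ∈ Φ₀} z_{lm}^t` — is rational over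
the fixed field of the squares of `Gal(ℍ′_{lm}/ℚ)` (the maximal sub-extension of exponent `2`), whereas on the `s = 1` classes a square moving
`P(n) = Z(n) ∓ …` exists (g7 `exists_sq_mover_of_card_selmer_eight`).  Proof: `Z(lm) = P(lm) ± 𝓛(l)·Z(m)`; squares fix `P(lm)` (silence); and
`𝓛(l)·Z(m) = c′·(2·P(m)) ≡ c′·u·𝓛(m)·α_m` up to a torsion point — `α_m` is `K_m`-rational hence fixed by `g²` (`g(√−m) = ±√−m`), torsion is fixed
by `g²` (`g(i) = ±i`, Lemma 3.18 for odd `n`).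

References: [cite: TianYuanZhang2017, §3.1 (p0011 L53–L73), Thm. 3.5 (p0011 L94–L100), Lemma 3.18 (p0017 L152–L153), Thm. 3.6 (1), (3), proof of
Lemma 3.21, Thm. 1.1]; [cite: HeathBrown1994SelmerCongruentII, Appendix (Monsky), typescript p. 39 L10–L41]; tree: p722669, p720648, g4
`…GaloisMotion`, g7 `…MoverSquares` (`apply_sqrtNeg_eq_or`), bsd-monsky `…ThetaGaloisBookkeeping` (`apply_im_eq_or`).
-/

noncomputable section

open scoped Classical NumberField

open WeierstrassCurve WeierstrassCurve.Affine Finset Matrix Literature.NumberTheory.EllipticCurves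
  Literature.NumberTheory.EllipticCurves.TianYuanZhang2017
  Literature.NumberTheory.EllipticCurves.TianYuanZhang2017.W2
  Literature.NumberTheory.EllipticCurves.HeathBrown1994
  Literature.NumberTheory.QuadraticFields.RingClass
  Literature.NumberTheory.QuadraticFields
  Summit.BirchSwinnertonDyer.Rank1Residual.P2
  Summit.BirchSwinnertonDyer.PrintCf2.QForm
  Summit.BirchSwinnertonDyer.PrintCf2.MoverAssembly
  Summit.BirchSwinnertonDyer.PrintCf2.LevelTwoTwoPrimes
  Summit.BirchSwinnertonDyer.PrintCf2.LayerOneSilenceOdd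

set_option autoImplicit false

namespace Summit.BirchSwinnertonDyer.PrintCf2.LayerOneSilencePeriod

variable {n : ℕ} (D : GenusPointData n)

/-! ## §1 Squares fix `K_d`-rational points (and `i`, `√−d`: g7 `mul_self_apply_im`, `mul_self_apply_sqrtNeg`) -/

/-- If `g(√−d) = √−d` then `g ∘ ι_d = ι_d` for the embedding `ι_d : K_d → ℍ′_n` (any divisor `d`; g4's `algHom_comp_embK_eq` is the case `d = n`). [folklore] -/
theorem algHom_comp_embK_eq_of_apply (g : D.H ≃ₐ[ℚ] D.H) {d : ℕ} (hd : d ∈ n.divisors) (hg : g (D.sqrtNeg d) = D.sqrtNeg d) :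
    (g : D.H →ₐ[ℚ] D.H).comp (D.embK d hd) = D.embK d hd := by
  apply AdjoinRoot.algHom_ext
  have h1 : (D.embK d hd) (AdjoinRoot.root (genusFieldPoly d)) = D.sqrtNeg d := AdjoinRoot.liftAlgHom_root _ _ _ _
  show g ((D.embK d hd) (AdjoinRoot.root (genusFieldPoly d))) = (D.embK d hd) (AdjoinRoot.root (genusFieldPoly d))
  rw [h1, hg]

/-- A `K_d`-rational point is fixed by every `g` with `g(√−d) = √−d`. [folklore] -/
theorem galPt_map_embK_eq (g : D.H ≃ₐ[ℚ] D.H) {d : ℕ} (hd : d ∈ n.divisors) (hg : g (D.sqrtNeg d) = D.sqrtNeg d)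
    (α : APoint (GenusField d)) :
    D.galPt g (Point.map (W' := curveA) (D.embK d hd) α) = Point.map (W' := curveA) (D.embK d hd) α := by
  change Point.map (W' := curveA) (g : D.H →ₐ[ℚ] D.H) (Point.map (W' := curveA) (D.embK d hd) α) = _
  rw [Point.map_map, algHom_comp_embK_eq_of_apply D g hd hg]

/-! ## §2 Squares fix `𝓛(l)·Z(m)` for the prime block -/

/-- **`g²` fixes `L·Z(m)` whenever `L = 2c′` is even and `2·P(m) ≡ (u·M)·α_m` modulo torsion with `α_m` `K_m`-rational, `P(m) = Z(m)`**
(odd `n`, Lemma 3.18 display for the torsion). [cite: TianYuanZhang2017, Thm. 3.5 (p0011 L94–L100), Lemma 3.18 (p0017 L152–L153)] -/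
theorem galPt_sq_smul_genusPeriod_prime_eq (hodd : Odd n) (h318 : D.lemma318) {m : ℕ} (hm : m ∈ n.divisors)
    (hPm : D.P m = D.Z m) {L c' u M : ℤ} (hL : L = 2 * c') {α : APoint (GenusField m)}
    (h35m : IsOfFinAddOrder ((2 : ℤ) • D.P m - (u * M) • Point.map (W' := curveA) (D.embK m hm) α)) (g : D.H ≃ₐ[ℚ] D.H) :
    D.galPt (g * g) (L • D.Z m) = L • D.Z m := by
  set t := (2 : ℤ) • D.P m - (u * M) • Point.map (W' := curveA) (D.embK m hm) α with ht
  have e : L • D.Z m = c' • t + (c' * (u * M)) • Point.map (W' := curveA) (D.embK m hm) α := by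
    rw [ht, hL, ← hPm]; module
  rw [e, map_add, map_zsmul, map_zsmul, GaloisMotion.galPt_eq_self_of_isOfFinAddOrder D hodd h318 (g * g) (mul_self_apply_im D g) h35m,
    galPt_map_embK_eq D (g * g) hm (mul_self_apply_sqrtNeg D g hm) α]

/-! ## §3 The two-prime sector: squares fix `Z(lm)` -/

/-- The tuple `![l, m]`: its product, primality, oddness, injectivity. [folklore] -/
theorem pair_facts {l m : ℕ} (hl : l.Prime) (hm : m.Prime) (hl8 : l % 8 = 1) (hm8 : m % 8 = 5 ∨ m % 8 = 7) :
    (∏ i, (![l, m] : Fin 2 → ℕ) i) = l * m ∧ (∀ i, ((![l, m] : Fin 2 → ℕ) i).Prime) ∧ (∀ i, Odd ((![l, m] : Fin 2 → ℕ) i)) ∧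
      Function.Injective (![l, m] : Fin 2 → ℕ) := by
  have hne : l ≠ m := by omega
  have hlo : Odd l := Nat.odd_iff.mpr (by omega)
  have hmo : Odd m := Nat.odd_iff.mpr (by omega)
  refine ⟨by simp [Fin.prod_univ_two], ?_, ?_, ?_⟩
  · intro i; fin_cases i <;> simpa
  · intro i; fin_cases i <;> simpa
  · intro i j h
    fin_cases i <;> fin_cases j <;> simp_all [hne.symm]

/-- **EVERY SQUARE OF `Gal(ℍ′_{lm}/ℚ)` FIXES THE GENUS PERIOD `Z(lm)`** on the two-prime sector `n = lm`, `l ≡ 1 (mod 8)`, `m ≡ 5` or `7 (mod 8)`,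
with `#Sel₂(E_n) = 2^{2+s}`, `s ≥ 2` (types R1/R2: `s = 3`), granted: the displays of the mover criterion (CM-point layer, conductor-2 ring class
dictionary, Frobenius clause; for the tuple `![l, m]`), the printed recursion / sign choices / `ε`-types, Lemma 3.18, Thm 1.1, `𝓛(l) = 2c′`, and
Thm 3.5 at the prime `m` inside `ℍ′_n` with a `K_m`-rational `α_m`.
[cite: TianYuanZhang2017, §3.1 (p0011 L53–L73), Thm. 3.5 (p0011 L94–L100), Lemma 3.18, Thm. 3.6 (1), (3), proof of Lemma 3.21, Thm. 1.1]
[cite: HeathBrown1994SelmerCongruentII, Appendix (Monsky), typescript p. 39 L10–L41] -/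
theorem galPt_sq_genusPeriod_eq_two_primes {l m : ℕ} (hl : l.Prime) (hm : m.Prime) (hl8 : l % 8 = 1) (hm8 : m % 8 = 5 ∨ m % 8 = 7)
    (hn : n = l * m) (hrec : D.recursion) (heps : D.epsSpec) (hLs : D.scriptLSpec) (h318 : D.lemma318)
    (z : ℕ → APoint D.H) (Φ : ℕ → Finset (D.H ≃ₐ[ℚ] D.H)) (ΓH ΓH' : ℕ → Subgroup (D.H ≃ₐ[ℚ] D.H))
    (σ : ℕ → (D.H ≃ₐ[ℚ] D.H)) (c : D.H ≃ₐ[ℚ] D.H) (ρ : (d : ℕ) → (D.galK d →* RingClassGroup (GenusField d) 2))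
    (hc : D.ConjSpec c)
    (hblock : ∀ d ∈ n.divisors, ((d % 8 = 5 ∨ d % 8 = 6) → D.CMBlockSpec d (z d) (Φ d) (ΓH d) (ΓH' d) (σ d) c) ∧
      (d % 8 = 7 → D.SevenBlockSpec d))
    (hring : ∀ d ∈ n.divisors, d % 8 = 5 → D.RingClassTwoBlockSpec d (ΓH d) (ΓH' d) (ρ d))
    (hFrob : ∀ d ∈ n.divisors, d % 8 = 5 → ∀ q : ℕ, q.Prime → q ∣ d → ∃ φ : D.H ≃ₐ[ℚ] D.H,
      φ (D.sqrtNeg d) = D.sqrtNeg d ∧ φ * φ ∈ ΓH' d ∧ φ D.im = (jacobiSym (-1) q) • D.im ∧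
        ∀ r : ℕ, r.Prime → r ∣ n → r ≠ q → φ (D.sqrtNeg r) = (jacobiSym (-(r : ℤ)) q) • D.sqrtNeg r)
    (h11 : thm11_parity_of_scriptL) {s : ℕ} (hs : 2 ≤ s)
    (hsel : Nat.card ((congruentNumberCurve n).selmerGroup 2) = 2 ^ (2 + s))
    {c' u : ℤ} (hLl : D.scriptL l = 2 * c') (hmdiv : m ∈ n.divisors) {α : APoint (GenusField m)}
    (h35m : IsOfFinAddOrder ((2 : ℤ) • D.P m - (u * D.scriptL m) • Point.map (W' := curveA) (D.embK m hmdiv) α))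
    (g : D.H ≃ₐ[ℚ] D.H) :
    D.galPt (g * g) (D.Z n) = D.Z n := by
  obtain ⟨hprod, hp, hpodd, hinj⟩ := pair_facts hl hm hl8 hm8
  have hn' : n = ∏ i, (![l, m] : Fin 2 → ℕ) i := by rw [hprod, hn]
  have h57 : n % 8 = 5 ∨ n % 8 = 7 := by
    rw [hn, mul_mod_eight_of_one hl8]; exact hm8
  have hodd : Odd n := Nat.odd_iff.mpr (by rcases h57 with h | h <;> omega)
  -- squares fix the genus POINT
  have hP : D.galPt (g * g) (D.P n) = D.P n :=
    galPt_sq_genusPoint_eq_of_card_selmer_odd (![l, m]) hp hpodd hinj D hn' h57 hrec hLs z Φ ΓH ΓH' σ c ρ hc hblock hring hFrob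
      h11 hs hsel g
  -- the closed form of the recursion
  obtain ⟨hPm, s₀, -, hPn⟩ := P_eq_of_two_primes hl hm hl8 hm8 hn D hrec heps
  have hZ : D.Z n = D.P n + s₀ • (D.scriptL l • D.Z m) := by rw [hPn]; abel
  rw [hZ, map_add, map_zsmul, hP, galPt_sq_smul_genusPeriod_prime_eq D hodd h318 hmdiv hPm hLl h35m g]

end Summit.BirchSwinnertonDyer.PrintCf2.LayerOneSilencePeriod

end
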